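import Literature.Analysis.Calculus.Sard
import Literature.Analysis.Calculus.SardSteps
import Literature.Analysis.Calculus.SardStepOne
import HarnessLib

/-!
# Sard's theorem — proof of the named fact `Literature.Analysis.Calculus.sard`

Topic `Literature/Analysis/Calculus`. We discharge the named fact
`Literature.Analysis.Calculus.sard` (A. Sard, *The measure of the critical values of differentiable
maps*, Bull. Amer. Math. Soc. 48 (1942), 883–890, Thms. 4.1 and 7.2, in the `C^∞` form printed by
Milnor, *Topology from the Differentiable Viewpoint* (1965), §3, p. 16): the critical values of a
`C^∞` map `f : ℝᵐ ⊇ U → ℝⁿ` form a Lebesgue-null set, in all dimensions `m, n`.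

The proof is Milnor's (§3, pp. 16–19), by induction on `m` simultaneously for all
finite-dimensional targets: with `C` the critical set and `Cₖ` the set of points of `U` where all
derivatives of orders `1, …, k` vanish, `C ⊆ (C ∖ C₁) ∪ ⋃_{1 ≤ k ≤ m} (Cₖ ∖ Cₖ₊₁) ∪ Cₘ₊₁`
(`dim E = m + 1`); the three kinds of pieces have null image by
`SardStepOne.exists_nhds_image_null_of_fderiv_ne_zero` (Step 1, Fubini over the slices of a chart
straightening one coordinate of `f`, using the induction hypothesis in dimension `m` for targets of
dimension `n - 1`), `SardSteps.exists_nhds_image_null_of_flat_of_ne` (Step 2, induction hypothesis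
on the hypersurface `{w = 0}` of a suitable `k`-th derivative `w`) and
`SardSteps.measure_image_null_of_flat` (Step 3, Taylor estimate and a Besicovitch covering), and a
locally-null image is null by second countability. The statement is proved for arbitrary
finite-dimensional real normed spaces and any additive Haar measure on the target
(`measure_image_setOf_not_surjective_fderiv_eq_zero`), then specialised to the model spaces
`EuclideanSpace ℝ (Fin _)` with Lebesgue measure `volume` (`sard_holds`).

* `Literature.Analysis.Calculus.Sard.measure_image_setOf_not_surjective_fderiv_eq_zero_aux` — the
  induction on `dim E`.
* `Literature.Analysis.Calculus.measure_image_setOf_not_surjective_fderiv_eq_zero` — Sard's theorem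
  for `C^∞` maps between finite-dimensional real normed spaces, any additive Haar measure.
* `Literature.Analysis.Calculus.sard_holds : sard` — the named fact, discharged.

## References

* A. Sard, *The measure of the critical values of differentiable maps*, Bull. Amer. Math. Soc.
  48 (1942), 883–890, Thms. 4.1, 7.2. [Sard1942]
* J. Milnor, *Topology from the Differentiable Viewpoint* (1965), §3, Theorem p. 16 and its proof,
  pp. 16–19. [MilnorTDV1965]
-/

open MeasureTheory Set Function Filter Metric
open scoped ContDiff Topology

noncomputable section

namespace Literature.Analysis.Calculus

universe u

namespace Sard

/-- **Sard's theorem by induction on the dimension of the source** (Milnor (1965), §3): for every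
real normed space `E` of dimension `m`, every finite-dimensional `F` with an additive Haar measure
`μ`, every open `U ⊆ E` and every `f` which is `C^∞` on `U`, the set of critical values
`f '' {x ∈ U | df(x) not surjective}` is `μ`-null. [cite: MilnorTDV1965, §3, Theorem p. 16]
[cite: Sard1942, Thms. 4.1, 7.2] -/
theorem measure_image_setOf_not_surjective_fderiv_eq_zero_aux (m : ℕ) :
    ∀ (E : Type u) [NormedAddCommGroup E] [NormedSpace ℝ E] [FiniteDimensional ℝ E],
      Module.finrank ℝ E = m →
      ∀ (F : Type u) [NormedAddCommGroup F] [NormedSpace ℝ F] [FiniteDimensional ℝ F]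
        [MeasurableSpace F] [BorelSpace F] (μ : Measure F) [μ.IsAddHaarMeasure]
        (f : E → F) (U : Set E), IsOpen U → ContDiffOn ℝ ∞ f U →
        μ (f '' {x ∈ U | ¬ Surjective (fderiv ℝ f x)}) = 0 := by
  induction m with
  | zero =>
    intro E _ _ _ hE F _ _ _ _ _ μ _ f U hU hf
    have hsub : Subsingleton E := Module.finrank_zero_iff.1 hE
    rcases (f '' {x ∈ U | ¬ Surjective (fderiv ℝ f x)}).eq_empty_or_nonempty with h | hne
    · rw [h, measure_empty]
    · obtain ⟨_, ⟨x, ⟨-, hxC⟩, rfl⟩⟩ := hne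
      -- `F` is nontrivial since `df(x)` is not surjective
      haveI : Nontrivial F := by
        by_contra hF
        rw [not_nontrivial_iff_subsingleton] at hF
        exact hxC fun y => ⟨0, Subsingleton.elim _ _⟩
      -- and the image is contained in the singleton `{f x}`
      have hsubset : f '' {x ∈ U | ¬ Surjective (fderiv ℝ f x)} ⊆ {f x} := by
        rintro _ ⟨y, -, rfl⟩
        rw [mem_singleton_iff, Subsingleton.elim y x]
      exact measure_mono_null hsubset (measure_singleton _)
  | succ m IH =>
    intro E _ _ _ hE F _ _ _ _ _ μ _ f U hU hf
    rcases subsingleton_or_nontrivial F with hF | hF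
    · -- every linear map onto a trivial space is surjective: no critical points
      have hempty : {x ∈ U | ¬ Surjective (fderiv ℝ f x)} = ∅ := by
        ext x
        simp only [mem_setOf_eq, mem_empty_iff_false, iff_false, not_and, not_not]
        exact fun _ y => ⟨0, Subsingleton.elim _ _⟩
      rw [hempty, image_empty, measure_empty]
    · -- the stratification `C ⊆ (C ∖ C₁) ∪ ⋃ₖ (Cₖ ∖ Cₖ₊₁) ∪ Cₘ₊₁`
      set C : Set E := {x ∈ U | ¬ Surjective (fderiv ℝ f x)} with hC
      set Cflat : ℕ → Set E := fun k =>
        {x ∈ U | ∀ j, 1 ≤ j → j ≤ k → iteratedFDeriv ℝ j f x = 0} with hCflat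
      have hcover : C ⊆ ({x ∈ C | fderiv ℝ f x ≠ 0} ∪
          ⋃ k ∈ Finset.Icc 1 m, {x ∈ Cflat k | iteratedFDeriv ℝ (k + 1) f x ≠ 0}) ∪
            Cflat (m + 1) := by
        intro x hx
        by_cases h0 : fderiv ℝ f x = 0
        swap
        · exact Or.inl (Or.inl ⟨hx, h0⟩)
        by_cases htop : x ∈ Cflat (m + 1)
        · exact Or.inr htop
        · refine Or.inl (Or.inr ?_)
          have h1 : iteratedFDeriv ℝ 1 f x = 0 := by
            rw [← norm_eq_zero, norm_iteratedFDeriv_one, h0, norm_zero]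
          classical
          have hP : ∃ j, 1 ≤ j ∧ j ≤ m + 1 ∧ iteratedFDeriv ℝ j f x ≠ 0 := by
            by_contra hall
            push Not at hall
            exact htop ⟨hx.1, fun j hj1 hjm => hall j hj1 hjm⟩
          obtain ⟨hj₀1, hj₀m, hj₀ne⟩ := Nat.find_spec hP
          have hmin : ∀ i < Nat.find hP, ¬ (1 ≤ i ∧ i ≤ m + 1 ∧ iteratedFDeriv ℝ i f x ≠ 0) :=
            fun i hi => Nat.find_min hP hi
          have hj₀2 : 2 ≤ Nat.find hP := by
            by_contra hlt
            have h1' : Nat.find hP = 1 := by omega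
            rw [h1'] at hj₀ne
            exact hj₀ne h1
          refine mem_iUnion₂.2 ⟨Nat.find hP - 1, Finset.mem_Icc.2 ⟨by omega, by omega⟩,
            ⟨hx.1, fun i hi1 hij => ?_⟩, ?_⟩
          · by_contra hne
            exact hmin i (by omega) ⟨hi1, by omega, hne⟩
          · have : Nat.find hP - 1 + 1 = Nat.find hP := by omega
            rw [this]
            exact hj₀ne
      -- each piece has null image: Step 1, Step 2, Step 3
      have hA : μ (f '' {x ∈ C | fderiv ℝ f x ≠ 0}) = 0 := by
        apply measure_image_null_of_locally
        rintro x ⟨⟨hxU, -⟩, hx0⟩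
        obtain ⟨V, hV, hnull⟩ :=
          exists_nhds_image_null_of_fderiv_ne_zero μ hE IH hU hf hxU hx0
        exact ⟨V, hV, measure_mono_null (image_mono
          (inter_subset_inter_left _ fun y hy => hy.1)) hnull⟩
      have hB : ∀ k, 1 ≤ k →
          μ (f '' {x ∈ Cflat k | iteratedFDeriv ℝ (k + 1) f x ≠ 0}) = 0 := by
        intro k hk
        apply measure_image_null_of_locally
        rintro x ⟨⟨hxU, -⟩, hxne⟩
        obtain ⟨V, hV, hnull⟩ := exists_nhds_image_null_of_flat_of_ne μ hE
          (fun E' _ _ _ hE' g W hW hg => IH E' hE' F μ g W hW hg) hU hf hk hxU hxne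
        exact ⟨V, hV, measure_mono_null (image_mono
          (inter_subset_inter_left _ fun y hy => hy.1)) hnull⟩
      have hCtop : μ (f '' Cflat (m + 1)) = 0 :=
        measure_image_null_of_flat μ hU hf hE.le (by omega)
      refine measure_mono_null (image_mono hcover) ?_
      rw [image_union, image_union]
      refine measure_union_null (measure_union_null hA ?_) hCtop
      rw [image_iUnion₂]
      exact (measure_biUnion_null_iff (Finset.countable_toSet _)).2 fun k hk =>
        hB k (Finset.mem_Icc.1 hk).1

end Sard

/-- **Sard's theorem** for `C^∞` maps between finite-dimensional real normed spaces (Sard 1942,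
Thms. 4.1, 7.2; Milnor 1965, §3): if `f` is `C^∞` on an open set `U ⊆ E`, then for every additive
Haar measure `μ` on `F` the set of critical values `f '' {x ∈ U | df(x) is not surjective}` is
`μ`-null. [cite: Sard1942, Thms. 4.1, 7.2] [cite: MilnorTDV1965, §3, Theorem p. 16] -/
theorem measure_image_setOf_not_surjective_fderiv_eq_zero {E : Type u} [NormedAddCommGroup E]
    [NormedSpace ℝ E] [FiniteDimensional ℝ E] {F : Type u} [NormedAddCommGroup F]
    [NormedSpace ℝ F] [FiniteDimensional ℝ F] [MeasurableSpace F] [BorelSpace F]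
    (μ : Measure F) [μ.IsAddHaarMeasure] {f : E → F} {U : Set E} (hU : IsOpen U)
    (hf : ContDiffOn ℝ ∞ f U) :
    μ (f '' {x ∈ U | ¬ Surjective (fderiv ℝ f x)}) = 0 :=
  Sard.measure_image_setOf_not_surjective_fderiv_eq_zero_aux _ E rfl F μ f U hU hf

/-- **Sard's theorem: the named fact `sard` holds** (Sard 1942, Thms. 4.1 (`m ≤ n`) and 7.2
(`m > n`, class `C^{m-n+1}` suffices; here `C^∞`); Milnor 1965, §3, Theorem p. 16): for every
`C^∞` map `f : U → ℝⁿ` on an open `U ⊆ ℝᵐ`, the critical values form a Lebesgue-null subset of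
`ℝⁿ = EuclideanSpace ℝ (Fin n)`. [cite: Sard1942, Thms. 4.1, 7.2]
[cite: MilnorTDV1965, §3, Theorem p. 16] -/
theorem sard_holds : sard := fun _ _ _ _ hU hf =>
  measure_image_setOf_not_surjective_fderiv_eq_zero volume hU hf

end Literature.Analysis.Calculus
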